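import Literature.MathematicalPhysics.QuantumLattice.LindhardSliceLevelCurve
import Mathlib.MeasureTheory.Function.JacobianOneDim
import Mathlib.Algebra.Polynomial.Roots
import HarnessLib

/-!
# The key lemma of the s-representation of the square-lattice Lindhard function:
# two slicings of the level curve of `W(s, y) = -2((1-s) cos y + s cos(y + q)) + s d`

Cell `gate-hubbard-kl`, item stmt-HubbardSuperconductivity-19294 `LindhardPointwiseIdentification`
(CERT-SREP §1 Prop. 1–2: `χ₀(q; μ) = ∫₀¹ ρ(μ; A₀(s), A₁(s)) ds`, the Feynman/"s"-parametrised form of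
the Lindhard function of Raghu–Kivelson–Scalapino eq. (5)). After Fubini in `p = (x, y)` the
identity for a FIXED first coordinate `x` reads, with `t = μ + 2 cos x`, `d = 2 cos x - 2 cos(x + q₀)`,
`q = q₁`, `w₀(y) = -2 cos y`, `W₁(y) = -2 cos(y+q) + d`, `D = W₁ - w₀` (`= ε(p+q) - ε(p)`) and
`4 A(s)² = 4 - 16 s(1-s) sin²(q/2)`:

  `∫⁻_{y ∈ [-π,π)} 𝟙[(w₀(y) < t) ≠ (W₁(y) < t)] / (|w₀(y) - t| + |W₁(y) - t|) dy`
  `= ∫⁻_{s ∈ (0,1)} 2 / √(4 A(s)² - (t - s d)²) ds`                         (`keyLemma_lindhard_slice`)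

Both sides are the coarea measure of the level curve `{W = t} ⊂ [0,1] × 𝕋` sliced along `y` (left:
the `T = 0` Lindhard integrand on the slice, `= 1/|D(y)|` where the occupations differ) and along
`s` (right: the density of states of `W(s,·)` at level `t`). Proof: the change of variables
`s = S(y) = (t - w₀(y))/D(y)` (Mathlib's `lintegral_image_eq_lintegral_abs_deriv_mul`) on the two
pieces `Y_±` where `±∂_y W(S(y), y) > 0`, on each of which `S` is injective with image exactly
`Σ = {s ∈ (0,1) | (t - sd)² < 4A(s)²}` (`LindhardSliceLevelCurve.lean`: `aniso_level_injOn`,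
`aniso_level_exists`, `aniso_slice_integrand`); the rest of the support, `{∂_y W(S y, y) = 0}`, is
countable (its `s`-values are roots of a non-zero quadratic). The hypotheses exclude exactly the
configurations in which one slicing misses a straight segment of the level curve: (H1)
`sin(q/2) ≠ 0 ∨ d ≠ 0` (else `D ≡ 0`), (H2) no `y` with `D(y) = 0 ∧ w₀(y) = t` (a vertical segment:
a crossing point of the Fermi curve and its `q`-translate on the line `k₀ = x`), (H3)
`¬(sin²(q/2) = 1 ∧ 2t = d)` (a horizontal segment: `A(1/2) = 0`); in the two-dimensional assembly
they fail for finitely many `x` only. Theorems only.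

## References
* S. Raghu, S. A. Kivelson, D. J. Scalapino, Phys. Rev. B 81 (2010) 224505, §II eq. (5) (the
  Lindhard function) [RaghuKivelsonScalapino2010].
-/

noncomputable section

open Real Set MeasureTheory MeasureTheory.Measure
open scoped Topology ENNReal

namespace Literature.MathematicalPhysics.QuantumLattice

/-! ### The key lemma: two slicings of the level curve -/

section KeyLemma

/-- Countability of a shifted cosine level set `{y | cos (y + φ) = c}`.
[cite: RaghuKivelsonScalapino2010, §II (5)] -/
theorem countable_setOf_cos_add_eq (φ c : ℝ) : Set.Countable {y : ℝ | Real.cos (y + φ) = c} := by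
  have : {y : ℝ | Real.cos (y + φ) = c} = (fun z : ℝ => z - φ) '' {z : ℝ | Real.cos z = c} := by
    ext y
    simp only [mem_setOf_eq, mem_image]
    constructor
    · intro h; exact ⟨y + φ, h, by ring⟩
    · rintro ⟨z, hz, rfl⟩; simpa using hz
  rw [this]
  exact (countable_setOf_cos_eq c).image _

/-- A level set `{y | W(s, y) = t}` of the interpolated band is countable unless its amplitude
vanishes (`A(s) = 0`). [cite: RaghuKivelsonScalapino2010, §II (5)] -/
theorem countable_aniso_level (s q d t : ℝ) (hA : 1 - 4 * s * (1 - s) * Real.sin (q / 2) ^ 2 ≠ 0) :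
    Set.Countable {y : ℝ | -2 * ((1 - s) * Real.cos y + s * Real.cos (y + q)) + s * d = t} := by
  obtain ⟨A, φ, hA0, hA2, hφ⟩ := aniso_phase_exists s q
  have hApos : 0 < A := by
    rcases hA0.lt_or_eq with h | h
    · exact h
    · exact absurd (by rw [← hA2, ← h]; ring) hA
  refine (countable_setOf_cos_add_eq φ ((s * d - t) / (2 * A))).mono fun y hy => ?_
  simp only [mem_setOf_eq] at hy ⊢
  rw [(hφ y).1] at hy
  field_simp
  linarith

/-- **The key lemma of the s-representation (one-dimensional Lindhard slice).** For reals
`t, d, q` put `w₀(y) = -2 cos y`, `W₁(y) = -2 cos(y+q) + d`, `D = W₁ - w₀`,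
`4A(s)² = 4 - 16 s(1-s) sin²(q/2)`. Assume (H1) `sin(q/2) ≠ 0 ∨ d ≠ 0`, (H2) no `y` with `D(y) = 0`
and `w₀(y) = t`, (H3) `¬(sin²(q/2) = 1 ∧ 2t = d)`. Then

`∫⁻_{y ∈ [-π,π)} 𝟙[(w₀(y) < t) ≠ (W₁(y) < t)] / (|w₀(y) - t| + |W₁(y) - t|) dy = ∫⁻_{s ∈ (0,1)} 2/√(4A(s)² - (t - sd)²) ds`

(both in `ℝ≥0∞` via `ENNReal.ofReal`; the left integrand is the zero-temperature Lindhard integrand of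
RKS eq. (5) on the slice, `= 1/|D(y)|` where the occupations differ; the right one is the
Feynman-parametrised form, the one-dimensional density of states of `W(s,·)` at level `t`).
Proof: change of variables `s = S(y) = (t - w₀(y))/D(y)` on the two pieces `σ ∂_y W(S y, y) > 0`,
`σ = ±1`, each mapped injectively onto `{s ∈ (0,1) | (t-sd)² < 4A(s)²}`; the complement
`{∂_y W(S y, y) = 0}` is countable by (H1), (H3). [cite: RaghuKivelsonScalapino2010, §II (5)] -/
theorem keyLemma_lindhard_slice (t d q : ℝ) (H1 : Real.sin (q / 2) ≠ 0 ∨ d ≠ 0)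
    (H2 : ∀ y : ℝ, d + (2 * Real.cos y - 2 * Real.cos (y + q)) = 0 → -2 * Real.cos y ≠ t)
    (H3 : ¬ (Real.sin (q / 2) ^ 2 = 1 ∧ 2 * t = d)) :
    ∫⁻ y in Ico (-π) π, ENNReal.ofReal (if (-2 * Real.cos y < t ↔ -2 * Real.cos (y + q) + d < t) then (0 : ℝ)
        else 1 / (|-2 * Real.cos y - t| + |-2 * Real.cos (y + q) + d - t|)) =
      ∫⁻ s in Ioo (0 : ℝ) 1, ENNReal.ofReal (2 / Real.sqrt (4 * (1 - 4 * s * (1 - s) * Real.sin (q / 2) ^ 2) - (t - s * d) ^ 2)) := by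
  -- the cast of characters
  set D : ℝ → ℝ := fun y => d + (2 * Real.cos y - 2 * Real.cos (y + q)) with hDdef
  set S : ℝ → ℝ := fun y => (t + 2 * Real.cos y) / (d + (2 * Real.cos y - 2 * Real.cos (y + q))) with hSdef
  set Wd : ℝ → ℝ := fun y => 2 * ((1 - (t + 2 * Real.cos y) / (d + (2 * Real.cos y - 2 * Real.cos (y + q)))) * Real.sin y +
      (t + 2 * Real.cos y) / (d + (2 * Real.cos y - 2 * Real.cos (y + q))) * Real.sin (y + q)) with hWddef
  set S' : ℝ → ℝ := fun y => -(2 * ((1 - (t + 2 * Real.cos y) / (d + (2 * Real.cos y - 2 * Real.cos (y + q)))) * Real.sin y +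
      (t + 2 * Real.cos y) / (d + (2 * Real.cos y - 2 * Real.cos (y + q))) * Real.sin (y + q))) /
      (d + (2 * Real.cos y - 2 * Real.cos (y + q))) with hS'def
  set R : ℝ → ℝ := fun s => 4 * (1 - 4 * s * (1 - s) * Real.sin (q / 2) ^ 2) - (t - s * d) ^ 2 with hRdef
  set G : ℝ → ℝ≥0∞ := fun s => ENNReal.ofReal (1 / Real.sqrt (R s)) with hGdef
  set V : Set ℝ := {y : ℝ | D y ≠ 0 ∧ S y ∈ Ioo (0 : ℝ) 1} with hVdef
  set Y : Set ℝ := Ico (-π) π ∩ V with hYdef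
  set Sg : Set ℝ := Ioo (0 : ℝ) 1 ∩ {s : ℝ | (t - s * d) ^ 2 < 4 * (1 - 4 * s * (1 - s) * Real.sin (q / 2) ^ 2)}
    with hSgdef
  -- measurability
  have hDc : Continuous D := by rw [hDdef]; fun_prop
  have hDm : Measurable D := hDc.measurable
  have hSm : Measurable S := by rw [hSdef]; fun_prop
  have hWdm : Measurable Wd := by rw [hWddef]; fun_prop
  have hVm : MeasurableSet V :=
    (hDm (measurableSet_singleton 0).compl).inter (measurableSet_Ioo.preimage hSm)
  have hYm : MeasurableSet Y := measurableSet_Ico.inter hVm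
  have hltm : MeasurableSet {s : ℝ | (t - s * d) ^ 2 < 4 * (1 - 4 * s * (1 - s) * Real.sin (q / 2) ^ 2)} :=
    measurableSet_lt (by fun_prop) (by fun_prop)
  have hSgm : MeasurableSet Sg := measurableSet_Ioo.inter hltm
  have hPm : ∀ σ : ℝ, MeasurableSet {y : ℝ | 0 < σ * Wd y} := fun σ =>
    measurableSet_lt measurable_const (measurable_const.mul hWdm)
  have hGm : Measurable G := by rw [hGdef, hRdef]; exact (by fun_prop : Measurable fun s : ℝ =>
    1 / Real.sqrt (4 * (1 - 4 * s * (1 - s) * Real.sin (q / 2) ^ 2) - (t - s * d) ^ 2)).ennreal_ofReal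
  ---------------------------------------------------------------------------------------------
  -- Step 1: the left integrand is `1/|D|` on `V` and `0` off `V`, up to a null set
  ---------------------------------------------------------------------------------------------
  have hN : (volume : Measure ℝ) ({y : ℝ | -2 * Real.cos y = t} ∪ {y : ℝ | -2 * Real.cos (y + q) + d = t}) = 0 := by
    refine Set.Countable.measure_zero (Set.Countable.union ?_ ?_) _
    · refine (countable_setOf_cos_eq (-t / 2)).mono fun y hy => ?_
      simp only [mem_setOf_eq] at hy ⊢; linarith
    · refine (countable_setOf_cos_add_eq q ((d - t) / 2)).mono fun y hy => ?_
      simp only [mem_setOf_eq] at hy ⊢; linarith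
  have hL : ∫⁻ y in Ico (-π) π, ENNReal.ofReal (if (-2 * Real.cos y < t ↔ -2 * Real.cos (y + q) + d < t) then (0 : ℝ)
        else 1 / (|-2 * Real.cos y - t| + |-2 * Real.cos (y + q) + d - t|)) =
      ∫⁻ y in Y, ENNReal.ofReal (1 / |D y|) := by
    rw [hYdef, inter_comm, ← Measure.restrict_restrict hVm, ← lintegral_indicator hVm]
    refine lintegral_congr_ae ?_
    refine (ae_restrict_of_ae (measure_eq_zero_iff_ae_notMem.1 hN)).mono fun y hy => ?_
    dsimp only
    simp only [mem_union, mem_setOf_eq, not_or] at hy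
    set u : ℝ := -2 * Real.cos y - t with hu
    set v : ℝ := -2 * Real.cos (y + q) + d - t with hv
    have hu0 : u ≠ 0 := fun h => hy.1 (by linarith)
    have hv0 : v ≠ 0 := fun h => hy.2 (by linarith)
    have hDuv : D y = v - u := by simp only [hDdef, hu, hv]; ring
    have hSuv : S y = -u / (v - u) := by
      show (t + 2 * Real.cos y) / (d + (2 * Real.cos y - 2 * Real.cos (y + q))) = -u / (v - u)
      rw [show d + (2 * Real.cos y - 2 * Real.cos (y + q)) = v - u by rw [hu, hv]; ring,
        show t + 2 * Real.cos y = -u by rw [hu]; ring]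
    have hiff1 : (-2 * Real.cos y < t) ↔ u < 0 := by rw [hu]; constructor <;> intro h <;> linarith
    have hiff2 : (-2 * Real.cos (y + q) + d < t) ↔ v < 0 := by rw [hv]; constructor <;> intro h <;> linarith
    have hmemV : y ∈ V ↔ v - u ≠ 0 ∧ 0 < -u / (v - u) ∧ -u / (v - u) < 1 := by
      rw [hVdef, mem_setOf_eq, hDuv, hSuv, mem_Ioo]
    rcases lt_or_gt_of_ne hu0 with hun | hup
    · rcases lt_or_gt_of_ne hv0 with hvn | hvp
      · -- both occupied: integrand `0`, `y ∉ V`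
        have hocc : (-2 * Real.cos y < t ↔ -2 * Real.cos (y + q) + d < t) := by
          rw [hiff1, hiff2]; exact ⟨fun _ => hvn, fun _ => hun⟩
        have hyV : y ∉ V := by
          rw [hmemV]
          rintro ⟨hne, h0, h1⟩
          rcases lt_or_gt_of_ne hne with hneg | hpos
          · have := div_neg_of_pos_of_neg (by linarith : 0 < -u) hneg; linarith
          · rw [div_lt_one hpos] at h1; linarith
        rw [if_pos hocc, ENNReal.ofReal_zero, Set.indicator_of_notMem hyV]
      · -- `u < 0 < v`: occupations differ, `y ∈ V`, `|u| + |v| = v - u = |D|`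
        have hocc : ¬ (-2 * Real.cos y < t ↔ -2 * Real.cos (y + q) + d < t) := by
          rw [hiff1, hiff2]; intro h; linarith [h.1 hun]
        have hyV : y ∈ V := by
          rw [hmemV]
          refine ⟨by linarith, div_pos (by linarith) (by linarith), ?_⟩
          rw [div_lt_one (by linarith)]; linarith
        rw [if_neg hocc, Set.indicator_of_mem hyV, hDuv]
        congr 2
        rw [show |-2 * Real.cos y - t| = |u| by rw [hu], show |-2 * Real.cos (y + q) + d - t| = |v| by rw [hv],
          abs_of_neg hun, abs_of_pos hvp, abs_of_pos (by linarith : 0 < v - u)]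
        ring
    · rcases lt_or_gt_of_ne hv0 with hvn | hvp
      · -- `v < 0 < u`: occupations differ
        have hocc : ¬ (-2 * Real.cos y < t ↔ -2 * Real.cos (y + q) + d < t) := by
          rw [hiff1, hiff2]; intro h; linarith [h.2 hvn]
        have hyV : y ∈ V := by
          rw [hmemV]
          refine ⟨by linarith, div_pos_of_neg_of_neg (by linarith) (by linarith), ?_⟩
          rw [div_lt_one_of_neg (by linarith)]; linarith
        rw [if_neg hocc, Set.indicator_of_mem hyV, hDuv]
        congr 2
        rw [show |-2 * Real.cos y - t| = |u| by rw [hu], show |-2 * Real.cos (y + q) + d - t| = |v| by rw [hv],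
          abs_of_pos hup, abs_of_neg hvn, abs_of_neg (by linarith : v - u < 0)]
        ring
      · -- both empty: integrand `0`, `y ∉ V`
        have hocc : (-2 * Real.cos y < t ↔ -2 * Real.cos (y + q) + d < t) := by
          rw [hiff1, hiff2]; exact ⟨fun h => absurd h (by linarith), fun h => absurd h (by linarith)⟩
        have hyV : y ∉ V := by
          rw [hmemV]
          rintro ⟨hne, h0, h1⟩
          rcases lt_or_gt_of_ne hne with hneg | hpos
          · rw [div_lt_one_of_neg hneg] at h1; linarith
          · have := div_neg_of_neg_of_pos (by linarith : -u < 0) hpos; linarith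
        rw [if_pos hocc, ENNReal.ofReal_zero, Set.indicator_of_notMem hyV]
  ---------------------------------------------------------------------------------------------
  -- Step 2: the two monotone pieces, each mapped by `S` onto `Sg`
  ---------------------------------------------------------------------------------------------
  have hpiece : ∀ σ : ℝ, σ = 1 ∨ σ = -1 →
      ∫⁻ y in Y ∩ {y : ℝ | 0 < σ * Wd y}, ENNReal.ofReal (1 / |D y|) = ∫⁻ s in Sg, G s := by
    intro σ hσ
    have hYσm : MeasurableSet (Y ∩ {y : ℝ | 0 < σ * Wd y}) := hYm.inter (hPm σ)
    have hsub : ∀ y ∈ Y ∩ {y : ℝ | 0 < σ * Wd y},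
        d + (2 * Real.cos y - 2 * Real.cos (y + q)) ≠ 0 ∧ S y ∈ Ioo (0 : ℝ) 1 ∧ 0 < σ * Wd y ∧ y ∈ Ico (-π) π :=
      fun y hy => ⟨hy.1.2.1, hy.1.2.2, hy.2, hy.1.1⟩
    have hWd0 : ∀ y ∈ Y ∩ {y : ℝ | 0 < σ * Wd y}, Wd y ≠ 0 := fun y hy h0 => by
      have := (hsub y hy).2.2.1; rw [h0, mul_zero] at this; exact lt_irrefl _ this
    have hderiv : ∀ y ∈ Y ∩ {y : ℝ | 0 < σ * Wd y}, HasDerivWithinAt S (S' y) (Y ∩ {y : ℝ | 0 < σ * Wd y}) y :=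
      fun y hy => (hasDerivAt_sliceS t d q y (hsub y hy).1).hasDerivWithinAt
    have hinj : InjOn S (Y ∩ {y : ℝ | 0 < σ * Wd y}) := by
      intro y₁ h₁ y₂ h₂ heq
      obtain ⟨hD₁, -, hs₁, hI₁⟩ := hsub y₁ h₁
      obtain ⟨hD₂, -, hs₂, hI₂⟩ := hsub y₂ h₂
      have hW₁ := aniso_W_sliceS t d q y₁ hD₁
      have hW₂ := aniso_W_sliceS t d q y₂ hD₂
      have heq' : (t + 2 * Real.cos y₂) / (d + (2 * Real.cos y₂ - 2 * Real.cos (y₂ + q))) =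
          (t + 2 * Real.cos y₁) / (d + (2 * Real.cos y₁ - 2 * Real.cos (y₁ + q))) := heq.symm
      rw [heq'] at hW₂
      have hs₂' : 0 < σ * (2 * ((1 - (t + 2 * Real.cos y₁) / (d + (2 * Real.cos y₁ - 2 * Real.cos (y₁ + q)))) *
          Real.sin y₂ + (t + 2 * Real.cos y₁) / (d + (2 * Real.cos y₁ - 2 * Real.cos (y₁ + q))) * Real.sin (y₂ + q))) := by
        have := hs₂; simp only [hWddef] at this; rwa [heq'] at this
      exact aniso_level_injOn _ q d σ hI₁ hI₂ (hW₁.trans hW₂.symm) hs₁ hs₂'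
    have himage : S '' (Y ∩ {y : ℝ | 0 < σ * Wd y}) = Sg := by
      ext s
      constructor
      · rintro ⟨y, hy, rfl⟩
        obtain ⟨hD0, hS01, hsgn, -⟩ := hsub y hy
        refine ⟨hS01, ?_⟩
        have hRsq := aniso_R_sliceS_eq_sq t d q y hD0
        have hpos : 0 < (Wd y) ^ 2 := by have := hWd0 y hy; positivity
        show (t - S y * d) ^ 2 < 4 * (1 - 4 * S y * (1 - S y) * Real.sin (q / 2) ^ 2)
        simp only [hSdef]
        simp only [hWddef] at hpos
        linarith
      · rintro ⟨hs01, hlt⟩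
        obtain ⟨y, hyI, hWy, hsgn⟩ := aniso_level_exists s q d t σ hσ hlt
        have hD0 : d + (2 * Real.cos y - 2 * Real.cos (y + q)) ≠ 0 := by
          intro h0
          refine H2 y h0 ?_
          have : -2 * ((1 - s) * Real.cos y + s * Real.cos (y + q)) + s * d =
              -2 * Real.cos y + s * (d + (2 * Real.cos y - 2 * Real.cos (y + q))) := by ring
          rw [this, h0, mul_zero, add_zero] at hWy
          exact hWy
        have hSy : S y = s := aniso_sliceS_eq_of_W_eq s t d q y hD0 hWy
        refine ⟨y, ⟨⟨hyI, hD0, ?_⟩, ?_⟩, hSy⟩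
        · show S y ∈ Ioo (0 : ℝ) 1
          rw [hSy]; exact hs01
        · show 0 < σ * Wd y
          have : Wd y = 2 * ((1 - S y) * Real.sin y + S y * Real.sin (y + q)) := rfl
          rw [this, hSy]; exact hsgn
    calc ∫⁻ y in Y ∩ {y : ℝ | 0 < σ * Wd y}, ENNReal.ofReal (1 / |D y|)
        = ∫⁻ y in Y ∩ {y : ℝ | 0 < σ * Wd y}, ENNReal.ofReal |S' y| * G (S y) :=
          setLIntegral_congr_fun hYσm fun y hy =>
            (aniso_slice_integrand t d q y (hsub y hy).1 (hWd0 y hy)).symm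
      _ = ∫⁻ s in S '' (Y ∩ {y : ℝ | 0 < σ * Wd y}), G s :=
          (lintegral_image_eq_lintegral_abs_deriv_mul hYσm hderiv hinj G).symm
      _ = ∫⁻ s in Sg, G s := by rw [himage]
  ---------------------------------------------------------------------------------------------
  -- Step 3: the rest of `Y` (where `∂_y W(S y, y) = 0`) is countable
  ---------------------------------------------------------------------------------------------
  have hZ : (volume : Measure ℝ) ((Y \ {y : ℝ | 0 < (1 : ℝ) * Wd y}) \ {y : ℝ | 0 < (-1 : ℝ) * Wd y}) = 0 := by
    set S₁ : ℝ := Real.sin (q / 2) ^ 2 with hS₁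
    set a₀ : ℝ := t ^ 2 - 4 with ha₀
    set a₁ : ℝ := 16 * S₁ - 2 * t * d with ha₁
    set a₂ : ℝ := d ^ 2 - 16 * S₁ with ha₂
    set P : Polynomial ℝ := Polynomial.C a₀ + Polynomial.C a₁ * Polynomial.X +
      Polynomial.C a₂ * Polynomial.X ^ 2 with hPdef
    have hPeval : ∀ s : ℝ, P.eval s = -(R s) := by
      intro s
      simp only [hPdef, hRdef, Polynomial.eval_add, Polynomial.eval_mul, Polynomial.eval_C,
        Polynomial.eval_X, Polynomial.eval_pow]
      rw [ha₀, ha₁, ha₂, hS₁]; ring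
    have hcoeff : ∀ n : ℕ, P.coeff n = (if n = 0 then a₀ else 0) + (if n = 1 then a₁ else 0) +
        (if n = 2 then a₂ else 0) := by
      intro n
      simp only [hPdef, Polynomial.coeff_add, Polynomial.coeff_C_mul, Polynomial.coeff_C,
        Polynomial.coeff_X_pow, Polynomial.coeff_X]
      rcases n with _ | _ | _ | n <;> simp
    have hP0 : P ≠ 0 := by
      intro hP
      have h0 : a₀ = 0 := by have := hcoeff 0; rw [hP] at this; simpa using this.symm
      have h1 : a₁ = 0 := by have := hcoeff 1; rw [hP] at this; simpa using this.symm
      have h2 : a₂ = 0 := by have := hcoeff 2; rw [hP] at this; simpa using this.symm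
      rw [ha₀] at h0; rw [ha₁] at h1; rw [ha₂] at h2
      have e1 : t * d = 8 * S₁ := by linarith
      have e2 : S₁ * (S₁ - 1) = 0 := by
        have : (t * d) ^ 2 = t ^ 2 * d ^ 2 := by ring
        rw [e1, show t ^ 2 = 4 by linarith, show d ^ 2 = 16 * S₁ by linarith] at this
        nlinarith
      rcases mul_eq_zero.1 e2 with hS0 | hS1
      · have hd0 : d = 0 := by nlinarith
        rcases H1 with h | h
        · exact h (pow_eq_zero_iff two_ne_zero |>.1 (hS₁ ▸ hS0))
        · exact h hd0
      · have hS1' : S₁ = 1 := by linarith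
        have : (2 * t - d) ^ 2 = 0 := by nlinarith
        exact H3 ⟨hS₁ ▸ hS1', by nlinarith [pow_eq_zero_iff two_ne_zero |>.1 this]⟩
    have hfin : {s : ℝ | P.IsRoot s}.Finite := Polynomial.finite_setOf_isRoot hP0
    have hLs : ∀ s ∈ {s : ℝ | P.IsRoot s},
        Set.Countable {y : ℝ | -2 * ((1 - s) * Real.cos y + s * Real.cos (y + q)) + s * d = t} := by
      intro s hs
      by_cases hA : 1 - 4 * s * (1 - s) * Real.sin (q / 2) ^ 2 = 0
      · exfalso
        have hroot : R s = 0 := by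
          have := hs; rw [mem_setOf_eq, Polynomial.IsRoot.def, hPeval] at this; linarith
        have hS1le : Real.sin (q / 2) ^ 2 ≤ 1 := Real.sin_sq_le_one _
        have hS1nn : 0 ≤ Real.sin (q / 2) ^ 2 := sq_nonneg _
        have h1 : Real.sin (q / 2) ^ 2 - 1 = (2 * s - 1) ^ 2 * Real.sin (q / 2) ^ 2 := by
          linear_combination (-1 : ℝ) * hA
        have hS1 : Real.sin (q / 2) ^ 2 = 1 :=
          le_antisymm hS1le (by nlinarith [mul_nonneg (sq_nonneg (2 * s - 1)) hS1nn])
        have hs12 : s = 1 / 2 := by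
          rw [hS1, sub_self, mul_one] at h1
          have := pow_eq_zero_iff two_ne_zero |>.1 h1.symm
          linarith
        have htd : (t - s * d) ^ 2 = 0 := by
          simp only [hRdef] at hroot; rw [hA] at hroot; linarith
        have := pow_eq_zero_iff two_ne_zero |>.1 htd
        rw [hs12] at this
        exact H3 ⟨hS1, by linarith⟩
      · exact countable_aniso_level s q d t hA
    have hZsub : (Y \ {y : ℝ | 0 < (1 : ℝ) * Wd y}) \ {y : ℝ | 0 < (-1 : ℝ) * Wd y} ⊆
        ⋃ s ∈ {s : ℝ | P.IsRoot s}, {y : ℝ | -2 * ((1 - s) * Real.cos y + s * Real.cos (y + q)) + s * d = t} := by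
      rintro y ⟨⟨hyY, h1⟩, h2⟩
      simp only [mem_setOf_eq, one_mul, neg_one_mul, not_lt, neg_nonpos] at h1 h2
      have hWd0 : Wd y = 0 := le_antisymm h1 h2
      have hD0 : d + (2 * Real.cos y - 2 * Real.cos (y + q)) ≠ 0 := hyY.2.1
      refine mem_iUnion₂.2 ⟨S y, ?_, aniso_W_sliceS t d q y hD0⟩
      show P.IsRoot (S y)
      rw [Polynomial.IsRoot.def, hPeval]
      have hRsq := aniso_R_sliceS_eq_sq t d q y hD0
      simp only [hWddef] at hWd0
      rw [hWd0] at hRsq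
      simp only [hRdef, hSdef]
      linarith
    exact measure_mono_null hZsub ((hfin.countable.biUnion hLs).measure_zero _)
  ---------------------------------------------------------------------------------------------
  -- Step 4: the right-hand side lives on `Sg`
  ---------------------------------------------------------------------------------------------
  have hRHS : ∫⁻ s in Ioo (0 : ℝ) 1, ENNReal.ofReal (2 / Real.sqrt (4 * (1 - 4 * s * (1 - s) * Real.sin (q / 2) ^ 2) -
      (t - s * d) ^ 2)) = (∫⁻ s in Sg, G s) + ∫⁻ s in Sg, G s := by
    rw [← lintegral_inter_add_sdiff _ (Ioo (0 : ℝ) 1) hltm]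
    have hz : ∫⁻ s in Ioo (0 : ℝ) 1 \ {s : ℝ | (t - s * d) ^ 2 < 4 * (1 - 4 * s * (1 - s) * Real.sin (q / 2) ^ 2)},
        ENNReal.ofReal (2 / Real.sqrt (4 * (1 - 4 * s * (1 - s) * Real.sin (q / 2) ^ 2) - (t - s * d) ^ 2)) = 0 := by
      refine setLIntegral_eq_zero (measurableSet_Ioo.diff hltm) fun s hs => ?_
      have hle : 4 * (1 - 4 * s * (1 - s) * Real.sin (q / 2) ^ 2) - (t - s * d) ^ 2 ≤ 0 := by
        have := hs.2; simp only [mem_setOf_eq, not_lt] at this; linarith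
      simp only [Pi.zero_apply]
      rw [Real.sqrt_eq_zero'.2 hle, div_zero, ENNReal.ofReal_zero]
    rw [hz, add_zero]
    have h2 : ∀ s ∈ Sg, ENNReal.ofReal (2 / Real.sqrt (4 * (1 - 4 * s * (1 - s) * Real.sin (q / 2) ^ 2) - (t - s * d) ^ 2)) =
        G s + G s := fun s _ => by
      simp only [hGdef, hRdef]
      rw [← ENNReal.ofReal_add (by positivity) (by positivity)]
      congr 1; ring
    rw [setLIntegral_congr_fun hSgm h2, lintegral_add_left hGm]
  ---------------------------------------------------------------------------------------------
  -- Assembly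
  ---------------------------------------------------------------------------------------------
  have hcut : (Y \ {y : ℝ | 0 < (1 : ℝ) * Wd y}) ∩ {y : ℝ | 0 < (-1 : ℝ) * Wd y} = Y ∩ {y : ℝ | 0 < (-1 : ℝ) * Wd y} := by
    ext y
    simp only [mem_inter_iff, mem_sdiff, mem_setOf_eq, one_mul, neg_one_mul]
    constructor
    · rintro ⟨⟨hY, -⟩, h⟩; exact ⟨hY, h⟩
    · rintro ⟨hY, h⟩; exact ⟨⟨hY, by linarith⟩, h⟩
  rw [hL, ← lintegral_inter_add_sdiff _ Y (hPm 1), ← lintegral_inter_add_sdiff _ (Y \ _) (hPm (-1)), hcut,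
    hpiece 1 (Or.inl rfl), hpiece (-1) (Or.inr rfl), setLIntegral_measure_zero _ _ hZ, add_zero, hRHS]

end KeyLemma

end Literature.MathematicalPhysics.QuantumLattice

end
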